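import Literature.MathematicalPhysics.QuantumFieldTheory.Balaban1983to89.B7ConclGauge
import Literature.MathematicalPhysics.QuantumFieldTheory.Balaban1983to89.B7Prop3to7Local
import Literature.MathematicalPhysics.QuantumFieldTheory.Balaban1983to89.B8Eq1115Concrete

/-!
# `Balaban1983to89.B7Prop8to10Local` — T. Bałaban, *Averaging operations for lattice gauge theories*, Commun. Math. Phys. **98**
(1985) 17–51 [Balaban1985Averaging]: **Propositions 8, 9, 10 (Sects. E–F, pp. 44–50) AS TYPED (`B7.Prop8Printed`, `B7.Prop9Printed`,
`B7.Prop10Printed`) WITH THE PRINTED LOCALITY, and the leaf `B7.Concl` INHABITED at carriers ALL of whose hypotheses are read on the boxes print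
names** (`concl_local`) — the gauge-transformation half of the located item (g1) «ℤᵈ-GLOBAL hypotheses ∕ RESTRICT» of node N04's reading, completing
`B7Prop1Local` (b07: Props. 1–2) and `B7Prop3to7Local` (this seat: Props. 3–7).

statement-level skeleton of published theorems with citation tags; proofs where landed; nothing here is a claim about the Yang–Mills mass gap

CITATION HEADER (lean-in-tree rule).  Cell `pub-ymgap`, seat `pub-ymgap-dag-n04-a` (Track-A DAG node N04 = [B7], KNIT-BY-NAME; generation g2,
2026-08-26), a B7 SUPPLEMENT to the lit-balaban r04 lineage (`B7ConclGauge`: the global families `concreteGaugeOneStep`, `concreteGaugeData` and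
`prop8∕9∕10Printed_G`) by the devices of b07 (`B7Prop1Local.clampCfg`, the clamped extension of the background) and of THIS file (the gauge
transformation `u′ ∘ π` clamped with the background, and the averaged gauge transformation `u₁` CONTINUED BY `1` off the box), with the tower-locality
theorems of the n04-b lineage BY NAME (`B8Ineq172Concrete.uavg_congr_tower`, `expr167_congr_tower`, `avgIter_agree_tower`, `hol_block_congr`;
`B8Eq1115Concrete.R0avg_congr_tower`, `utilG_congr_tower`; the tower boxes `B8Ineq130.tlo`/`thi`).  Kernels BY NAME: `B7Prop8PrintedConstants.prop8_printed_of52`,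
`B7Ineq199General.eq199_printed`, `B7Ineq200General.eq200_printed`, `B7Prop10AsPrinted.prop10_as_printed_of52` (pointwise forms).  It answers, for Props.
8–10, pub-ymgap ref-A's [REFA-G2-N04-LOCALITY-READ] «the (g1) RESTRICT rider … REMAINS for Props. 8–10 only (gauge carriers)».

PRINT (verbatim; journal page = PDF page + 16).  p. 44, (166)–(167): «`|u(x) − 1| < α₃`, … `|(\overline{R₀u}ʲ)⁻¹(x_{j+1})(R̄ʲ_{0,x_{j+1}}\overline{R₀u}ʲ)(x_j) − 1|
< α₃Lʲ⁺¹η`, `x_{j+1} ∈ Ω^{(j+1)}`, `x_j ∈ B(x_{j+1})`, `j = 0, 1, …, k − 1` (167) … the class `Λ_k(U₀, α₃)`»; Prop. 8 p. 45: «If `u₁, u₂ ∈ Λ_k(U₀, α₃)` and `α₃` is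
sufficiently small, i.e., `α₃ ≦ c₆` for some `c₆`, then `u = u₁u₂ ∈ Λ_k(U₀, 2α₃ + 2C₃α₃²)` and we have (173).»; (176)–(177) p. 45: «`|u′(x) − 1| < α₄`, (176)
`|u′⁻¹(b₋)R_{0,b}u′(b₊) − 1| < α₄η` (177)»; (180) p. 46: «`|V₀(∂p) − 1| < α₀`, `|v′(y) − 1| < α₄`, `|v′⁻¹(b₋)R_{0,b}v′(b₊) − 1| < α′₄`, `|v₁(y) − 1| < α₃`,
`|v₁⁻¹(y)(R₀v₁)(x) − 1| < Lα′₃`, `x ∈ B(y)`»; Prop. 9 p. 49: «There exist positive constants `C′₄, C′₅, c′₆` such that for arbitrary functions `V₀, v′, v₁`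
satisfying (180) with `α₀, α₃, α′₃, α₄, α′₄ ≦ c′₆`, the following bounds hold: `|ṽ′⁻¹(c₋)R̄_{0,c}ṽ′(c₊) − 1| < Lα′₄ + C′₄L²(α₀α₄ + α′₃α′₄ + α′₄²)`, (199)
`|ṽ′(y) − 1| < α₄ + C′₅Lα′₄`. (200)»; Prop. 10 p. 50: «There exist positive constants `C₄, C₅, c₆` such that for arbitrary configurations `U₀, u′, u₁` satisfying
(52), (176), (177), (166), (167) with `α₀, α₃, α₄ ≦ c₆` the bounds (203), (204) hold for `j ≦ k`.»; p. 24 (after (43)): «this definition is local in the sense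
that `Ū^k_c`, `c ⊂ Ω^{(k)}`, depends only on the bond variables `U_b` for `b ⊂ B^k(c₋) ∪ B^k(c₊)`»; p. 31 (after (91)): the operations (89)–(91) (twisted averages
of gauge transformations included, (78)–(80) p. 30) «have the same locality properties».

DICTIONARY (print ↦ Lean; conventions of `B7Prop1Local` / `B7ConclGauge` / `B8Ineq130`).  The fine block `Bʲ(w)` of the level-`j` site `w` ↦
`[tlo L w j, thi L w j] = [Lʲw, Lʲ(w+𝟙) − 𝟙]`; «`Bʲ(w) ⊂ Q`» ↦ `BlockIn L lo hi j w`; the box of the bond `c = ⟨z, z + e_κ⟩` of `Ω^{(k)}` ↦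
`Q_c = [tlo L z k, thi L (z + e_κ) k] = Bᵏ(c₋) ∪ Bᵏ(c₊)` (`= [loK L k z, bondHiK L k z κ]`, `loK_eq_tlo`, `bondHiK_eq_thi`); (176)/(180a) on `Q` ↦ `SiteBdOn`,
(177)/(180b) on `Q` ↦ `CovBondBdOn`, (180d) on `Q` ↦ `CovBlockBdOn`, (166)/(167) on `Q` ↦ `Cond166On`/`Cond167On`, `Λ_k(U₀, α₃)` on `Q` ↦ `InLambdaOn`
(the global twins are `B7Prop9Flat.SiteBd`, `B7Prop9General.CovBondBd`/`CovBlockBd`, `B7Eq167Flat.Cond166`/`Cond167`/`InLambda`).  NOT IN PRINT (devices of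
this file): the extension of the averaged gauge transformation by `1` off the box (`extOne`) — its twisted averages (79)/(80) are the identity on every block
missing the box (`uavg_ext_eq_one_of_disjoint`), so (166)/(167)/(180c,d) hold there trivially —, the clamped gauge transformation `u′ ∘ π` (`compClamp`), and the
DICHOTOMY `blockIn_or_disjoint`: a level-`j` block, `j ≤ k`, lies inside a union of level-`k` blocks or misses it.

WHAT THIS FILE PROVES (kernel, no `sorry`, standard axioms).
* §1 the box-local predicates; §2 block geometry (`blockIn_or_disjoint`, `tower_nest`, `blockIn_of_mem`, `loK_eq_tlo`, `bondHiK_eq_thi`, `bondHi_eq_thi`);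
  §3 the extensions `extOne`, `compClamp` (+ API); §4 TRANSFER — local hypotheses ⟹ global hypotheses of the extended data: `siteBd_compClamp`, `siteBd_extOne`,
  `covBondBd_clamp`, `covBlockBd_ext`, `uavg_one_fun`, `uavg_ext_eq_of_blockIn`, `uavg_ext_eq_one_of_disjoint`, **`inLambda_ext`**, `inLambdaOn_of_ext`.
* §5 the LOCAL one-step family `concreteGaugeOneStepLocal 𝔸 L : Site d × Fin d → B7.GaugeOneStep` ((180) on `B(c₋) ∪ B(c₊)`; (199) at `c`, (200) at `c₋`) with
  `vtilG_ext_eq` and **`prop9Printed_G_local`** (every `d`, `L ≥ 1`, every ratio `M`; constants of `B7ConclGauge.prop9Printed_G`: `C′₄ = 2400(d+1)(d+4)+1`, `C′₅ = 6d+1`,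
  `c′₆ = c9 d L`).
* §6 the LOCAL gauge-transformation family `concreteGaugeDataLocal 𝔸 L : GIdxLocal 𝔸 d L → B7.GaugeData` (index `(k; c; U₀)` with `U₀` unitary AND (52) at `c₂`
  ON `Q_c` only — the located item (c2) of the N04 reading is localised with it; (52)/(176)/(177)/(166)/(167) on `Q_c`; (203)ⱼ/(204)ⱼ as the suprema over the
  level-`j` bonds `b` with `Bʲ(b₋) ∪ Bʲ(b₊) ⊂ Q_c`, resp. sites `y` with `Bʲ(y) ⊂ Q_c`) with `utilG_ext_eq`, `avgIter_ext_eq`, **`prop8Printed_G_local`** (`C₃ = 1116`,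
  `c₆ = 1/3000`) and **`prop10Printed_G_local`** (`C₄ = C4 d + 1`, `C′₅ = C5' d + 1`, `c₆ = c10 d L`), `p8_and_p10_G_local`.
* §7 `concreteOneStepLocalUnion` (b07's Prop-1 family ⊕ g2's Prop-3 family), `prop1∕3Printed_localUnion`, and **`concl_local`**: `B7.Concl L (cB d L) (C0 d) (c2' d L)`
  at the five LOCAL families, every `d`, `L ≥ 2`, every nontrivial C⋆-algebra `𝔸`, `G = U(𝔸)`; §8 `prop2Printed_concreteLocal_of_le` and **`concl_local_specialUnitary`**
  (the local leaf with the averaged fields in `SU(N) ≤ U(N)`, every `N ≥ 1`; cf. `B7ConclSubgroup.concl_specialUnitary`).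
METHOD.  Given data `(U₀, u′, u₁)` satisfying the hypotheses on the box `Q` (a union of level-`k` blocks), the extended data `(π^*U₀, u′ ∘ π, u₁ continued by 1)`
satisfy them on all of `ℤᵈ`: the background by b07's case analysis (`pdev_clampCfg_le_of_box`); (176)/(177) because a bond either clamps to a genuine bond of `Q`
(same expression) or degenerates (background `1`, both ends at one site: expression `1`); (166)/(167)/(180c,d) because every level-`j` block lies inside `Q` — where
the twisted averages are the box's own (tower locality) — or misses `Q` — where `u₁ ≡ 1` and all twisted averages are `1`.  The pointwise kernels at the extended
data give (173)/(199)/(200)/(203)/(204) at every bond ∕ site; at those inside `Q` the expressions are the data's own (`utilG_congr_tower`, `R0avg_congr_tower`,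
`avgIter_congr`, `bavg_congr`).  No gauge fixing, no new estimate; constants unchanged.

READINGS / DIVERGENCES (located).  (a) CONCLUSIONS READ AT THE INDEX: (199) at the bond `c`, (200) at `c₋`; (203)ⱼ/(204)ⱼ (`j ≤ k`) as suprema over the
level-`j` bonds ∕ sites whose boxes lie in `Q_c` (for `j = k`: `c` itself ∕ its endpoints) — the global families type suprema over ALL bonds ∕ sites, which have no
local analogue; Prop. 8's conclusion `u₁u₂ ∈ Λ_k(U₀, ·)` is read ON `Q_c` like its hypotheses.  (b) HYPOTHESIS REGION = `Q_c` read as its set of fine SITES (the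
fewest plaquettes ∕ bonds ∕ blocks), so the statements imply the printed ones under any reading of «on `Ω`», `Ω ⊇ Q_c`.  (c) Inherited from `B7ConclGauge`: Banach∕C⋆
carriers, `U(𝔸)` for `U(N)`; `≤` in the hypothesis predicates for print's `<`; the background in the index of the `GaugeData` family (finding F6 of r04); the
one-step family's `Cfg` `U1`-valued and `GT` bounded on all of `ℤᵈ` (immaterial: extend by `1`).  (d) `concl_local`'s one-step family is the disjoint union of the
Prop-1 and Prop-3 local families (each proposition genuine on its own summand, trivially true on the other) — `B7.Concl` asks ONE family for `p1`, `p3`.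
NOT CLAIMED: the node statement of record (`Dag.B7_main` at NODE 00's global carriers) is unchanged — this file is the located item (g1) of its READING in
kernel form; nothing about other carriers; nothing of the series' end-statement.  DECLARATIONS: the predicates of §1, `extOne`, `compClamp`, `GIdxLocal`, the
families `concreteGaugeOneStepLocal`, `concreteGaugeDataLocal`, `concreteOneStepLocalUnion`, theorems.  Finite lattice geometry; NOT continuum ∕ OS ∕ mass gap.

[cite: Balaban1985Averaging, Proposition 8 p.45, Proposition 9 (199)–(200) p.49, Proposition 10 p.50, (203)–(204) p.49, (166)–(167) p.44, (176)–(180) pp.45–46, (78)–(80) p.30, p.24 (sentence after (43)), p.31 (sentence after (91))]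
-/

noncomputable section

open scoped BigOperators
open NormedSpace

namespace Literature.MathematicalPhysics.QuantumFieldTheory.Balaban1983to89.B7Prop8to10Local

open B7Prop1Explicit B7Prop2Explicit B7Eq92Concrete B7Eq99Concrete B7Eq84Concrete B7Eq167Flat B7ConclGauge
open B7Prop9Flat (SiteBd)
open B7Prop9General (vtilG vtilG_apply CovBondBd CovBlockBd)
open B7Prop10General (utilG utilG_zero utilG_succ)
open B7Prop1Local (InBox AgreeOn PlaqIn loK bondHiK bondHi clamp clampCfg clampCfg_agree clamp_inBox clamp_add_e_of clamp_of_inBox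
  clamp_add_e_of_not hol_plaqWord_clampCfg pdevOn pdevOn_nonneg add_e_apply avgIter_congr hol_treeWord_congr bavg_congr
  norm_hol_plaqWord_clampCfg_le)
open B7Prop3to7Local (clampCfg_mem_of_box pdev_clampCfg_le_of_box regimeOn_of_dev_lt)
open B8Ineq130 (tlo thi tlo_zero thi_zero tlo_apply thi_apply tlo_succ tlo_le_thi block_mem smul_mem inBox_of_le)
open B8Ineq172Concrete (avgIter_agree_tower hol_block_congr uavg_congr_tower expr167_congr_tower)
open B8Eq1115Concrete (R0avg_congr_tower utilG_congr_tower)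

-- `Site` alone would resolve to the torus sites of `Setup.lean`; re-export the `ℤ^d` sites of `B7Prop1Explicit`.
export B7Prop1Explicit (Site)

variable {d : ℕ}

/-! ## §1 Box-local predicates: (176)/(180a), (177)/(180b), (180d), (166)–(167) read on a box -/

section Predicates

variable {𝔸 : Type*} [NormedRing 𝔸]

/-- **A fine block inside the box**: the level-`j` block `Bʲ(w) = [Lʲw, Lʲ(w+𝟙) − 𝟙]` (fine sites, `B8Ineq130.tlo`/`thi`) has both corners in
`[lo, hi]` (for boxes this is «`Bʲ(w) ⊂` the box»). [cite: Balaban1985Averaging, p.24 (sentence after (43)); Balaban1984PropagatorsI, (1.6) p.20 (blocks)] -/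
def BlockIn (L : ℕ) (lo hi : Site d) (j : ℕ) (w : Site d) : Prop :=
  InBox lo hi (tlo L w j) ∧ InBox lo hi (thi L w j)

/-- **(176)/(180a) ON THE BOX**: `‖v(x) − 1‖ ≤ α` for the sites `x ∈ [lo, hi]` (cf. the global `B7Prop9Flat.SiteBd`).
[cite: Balaban1985Averaging, (176) p.45, (180) p.46] -/
def SiteBdOn (lo hi : Site d) (v : Site d → 𝔸ˣ) (α : ℝ) : Prop :=
  ∀ x : Site d, InBox lo hi x → ‖((v x : 𝔸ˣ) : 𝔸) - 1‖ ≤ α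

/-- **(177)/(180b) ON THE BOX**: `‖v(b₋)⁻¹R(V₀(b))v(b₊) − 1‖ ≤ α` for the bonds `b` with both endpoints in `[lo, hi]` (cf. the global
`B7Prop9General.CovBondBd`). [cite: Balaban1985Averaging, (177) p.45, (180) p.46, (56) p.27] -/
def CovBondBdOn (lo hi : Site d) (V₀ : Site d → Fin d → 𝔸ˣ) (v : Site d → 𝔸ˣ) (α : ℝ) : Prop :=
  ∀ (x : Site d) (κ : Fin d), InBox lo hi x → InBox lo hi (x + e κ) →
    ‖((((v x)⁻¹ * Rc (V₀ x κ) (v (x + e κ)) : 𝔸ˣ)) : 𝔸) - 1‖ ≤ α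

/-- **(180d) ON THE BOX** (one step): `‖v(y)⁻¹(R_{0,y}v)(x) − 1‖ ≤ β` for the blocks `B(y)`, `y = Lw`, INSIDE `[lo, hi]` and `x ∈ B(y)` (cf. the
global `B7Prop9General.CovBlockBd`). [cite: Balaban1985Averaging, (180) p.46, p.27 (display after (59))] -/
def CovBlockBdOn (L : ℕ) (lo hi : Site d) (V₀ : Site d → Fin d → 𝔸ˣ) (v : Site d → 𝔸ˣ) (β : ℝ) : Prop :=
  ∀ (w : Site d) (r : Fin d → Fin L), BlockIn L lo hi 1 w →
    ‖((((v ((L : ℤ) • w))⁻¹ * R0fun V₀ ((L : ℤ) • w) v ((L : ℤ) • w + boxVec L r) : 𝔸ˣ)) : 𝔸) - 1‖ ≤ β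

variable [NormedAlgebra ℂ 𝔸] [CompleteSpace 𝔸]

/-- **(166) ON THE BOX**: `‖(\overline{R₀u}ʲ)(x_j) − 1‖ ≤ α₃` for `j ≤ k` and the level-`j` sites `x_j` whose block `Bʲ(x_j)` lies in `[lo, hi]`
(cf. the global `B7Eq167Flat.Cond166`). [cite: Balaban1985Averaging, (166) p.44, (79)–(80) p.30] -/
def Cond166On (L : ℕ) (lo hi : Site d) (U₀ : Site d → Fin d → 𝔸ˣ) (u : Site d → 𝔸ˣ) (k : ℕ) (α₃ : ℝ) : Prop :=
  ∀ j ≤ k, ∀ w : Site d, BlockIn L lo hi j w → ‖((uavg L U₀ u j w : 𝔸ˣ) : 𝔸) - 1‖ ≤ α₃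

/-- **(167) ON THE BOX**: the expression of (167) bounded by `α₃Lʲ⁺¹η` for `j < k`, the level-`(j+1)` sites `x_{j+1}` whose block `Bʲ⁺¹(x_{j+1})`
lies in `[lo, hi]`, and `x_j ∈ B(x_{j+1})` (cf. the global `B7Eq167Flat.Cond167`). [cite: Balaban1985Averaging, (167) p.44] -/
def Cond167On (L : ℕ) (lo hi : Site d) (U₀ : Site d → Fin d → 𝔸ˣ) (u : Site d → 𝔸ˣ) (k : ℕ) (α₃ η : ℝ) : Prop :=
  ∀ j < k, ∀ (w : Site d) (r : Fin d → Fin L), BlockIn L lo hi (j + 1) w →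
    ‖(((uavg L U₀ u j ((L : ℤ) • w))⁻¹
        * Rc (hol (avgIter L U₀ j) ((L : ℤ) • w) (treeWord (boxVec L r)))
            (uavg L U₀ u j ((L : ℤ) • w + boxVec L r)) : 𝔸ˣ) : 𝔸) - 1‖
      ≤ α₃ * (L : ℝ) ^ (j + 1) * η

/-- **«`u ∈ Λ_k(U₀, α₃)` ON THE BOX»**: (166) and (167) for the blocks inside `[lo, hi]` (cf. `B7Eq167Flat.InLambda`).
[cite: Balaban1985Averaging, (166)–(167) p.44] -/
def InLambdaOn (L : ℕ) (lo hi : Site d) (U₀ : Site d → Fin d → 𝔸ˣ) (u : Site d → 𝔸ˣ) (k : ℕ) (α₃ η : ℝ) : Prop :=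
  Cond166On L lo hi U₀ u k α₃ ∧ Cond167On L lo hi U₀ u k α₃ η

end Predicates

/-! ## §2 Block-aligned boxes: the dichotomy «a block lies inside the box or misses it» -/

section Blocks

/-- **DICHOTOMY** for the box `Q = [Lᵏa, Lᵏ(b+𝟙) − 𝟙]` (a union of level-`k` blocks, `a ≤ b`) and a level-`j` block `Bʲ(w)`, `j ≤ k`: either `Bʲ(w) ⊂ Q`,
or NO fine site of `Bʲ(w)` lies in `Q` (blocks of level `j ≤ k` tile the level-`k` blocks). [cite: Balaban1984PropagatorsI, (1.6) p.20; Balaban1985Averaging, (1) p.17 (the lattices Ω^{(j)})] -/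
theorem blockIn_or_disjoint {L : ℕ} (hL : 1 ≤ L) {a b : Site d} {j k : ℕ} (hjk : j ≤ k) (w : Site d) :
    BlockIn L (tlo L a k) (thi L b k) j w ∨
      ∀ x : Site d, InBox (tlo L w j) (thi L w j) x → ¬ InBox (tlo L a k) (thi L b k) x := by
  have hL1 : (1 : ℤ) ≤ (L : ℤ) := by exact_mod_cast hL
  have hPj : (1 : ℤ) ≤ (L : ℤ) ^ j := one_le_pow₀ hL1
  have hM : (1 : ℤ) ≤ (L : ℤ) ^ (k - j) := one_le_pow₀ hL1
  have hLk : (L : ℤ) ^ k = (L : ℤ) ^ j * (L : ℤ) ^ (k - j) := by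
    rw [← pow_add, Nat.add_sub_cancel' hjk]
  by_cases h : ∀ i, (L : ℤ) ^ (k - j) * a i ≤ w i ∧ w i + 1 ≤ (L : ℤ) ^ (k - j) * (b i + 1)
  · left
    refine ⟨fun i => ⟨?_, ?_⟩, fun i => ⟨?_, ?_⟩⟩
    · rw [tlo_apply, tlo_apply, hLk]
      nlinarith [(h i).1, hPj]
    · rw [tlo_apply, thi_apply, hLk]
      nlinarith [(h i).2, hPj]
    · rw [tlo_apply, thi_apply, hLk]
      nlinarith [(h i).1, hPj]
    · rw [thi_apply, thi_apply, hLk]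
      nlinarith [(h i).2, hPj]
  · right
    push Not at h
    obtain ⟨i, hi⟩ := h
    intro x hx hQ
    have hx1 := (hx i).1
    have hx2 := (hx i).2
    have hq1 := (hQ i).1
    have hq2 := (hQ i).2
    rw [tlo_apply] at hx1 hq1
    rw [thi_apply] at hx2 hq2
    rw [hLk] at hq1 hq2
    by_cases hlt : (L : ℤ) ^ (k - j) * a i ≤ w i
    · have h2 := hi hlt
      -- `w i ≥ L^{k-j}(b i + 1)`: the block starts above the box
      nlinarith
    · push Not at hlt
      -- `w i + 1 ≤ L^{k-j} a i`: the block ends below the box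
      nlinarith

/-- A site of a block inside the box lies in the box. [cite: Balaban1985Averaging, p.24 (sentence after (43)); Balaban1984PropagatorsI, (1.6) p.20 (blocks; bookkeeping, our proof)] -/
theorem inBox_of_blockIn {L : ℕ} {lo hi : Site d} {j : ℕ} {w : Site d} (h : BlockIn L lo hi j w) {x : Site d}
    (hx : tlo L w j ≤ x) (hx' : x ≤ thi L w j) : InBox lo hi x :=
  fun i => ⟨(h.1 i).1.trans (hx i), (hx' i).trans (h.2 i).2⟩

/-- Agreement on the box restricts to agreement on a block inside it. [cite: Balaban1985Averaging, p.24 (sentence after (43)) (bookkeeping, our proof)] -/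
theorem agreeOn_block {G : Type*} {L : ℕ} {lo hi : Site d} {j : ℕ} {w : Site d} (h : BlockIn L lo hi j w)
    {V V' : Site d → Fin d → G} (hV : AgreeOn lo hi V V') : AgreeOn (tlo L w j) (thi L w j) V V' :=
  hV.mono (fun i => (h.1 i).1) (fun i => (h.2 i).2)

end Blocks


/-- **Tower nesting**: the fine level-`j` block of a level-`j` site `v` of the depth-`n` cube of the tower rooted at `y` lies in the fine
level-`(n+j)` block of `y`. [cite: Balaban1984PropagatorsI, (1.6) p.20 (blocks); Balaban1985Averaging, (1) p.17] -/
theorem tower_nest {L : ℕ} (hL : 1 ≤ L) {y v : Site d} {n : ℕ} (hv : tlo L y n ≤ v) (hv' : v ≤ thi L y n) (j : ℕ) {m : ℕ}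
    (hm : n + j = m) : tlo L y m ≤ tlo L v j ∧ thi L v j ≤ thi L y m := by
  subst hm
  have hL1 : (1 : ℤ) ≤ (L : ℤ) := by exact_mod_cast hL
  have hPj : (1 : ℤ) ≤ (L : ℤ) ^ j := one_le_pow₀ hL1
  constructor
  · intro i
    have h1 := hv i
    rw [tlo_apply] at h1
    rw [tlo_apply, tlo_apply, pow_add]
    nlinarith
  · intro i
    have h1 := hv' i
    rw [thi_apply] at h1
    rw [thi_apply, thi_apply, pow_add]
    nlinarith

/-- The blocks `Bᵏ(w)`, `a ≤ w ≤ b`, lie in the box `[Lᵏa, Lᵏ(b+𝟙) − 𝟙]`. [cite: Balaban1984PropagatorsI, (1.6) p.20 (blocks)] -/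
theorem blockIn_of_mem {L : ℕ} (hL : 1 ≤ L) {a b w : Site d} (k : ℕ) (ha : a ≤ w) (hb : w ≤ b) :
    BlockIn L (tlo L a k) (thi L b k) k w := by
  have hL1 : (1 : ℤ) ≤ (L : ℤ) := by exact_mod_cast hL
  have hP : (1 : ℤ) ≤ (L : ℤ) ^ k := one_le_pow₀ hL1
  refine ⟨fun i => ⟨?_, ?_⟩, fun i => ⟨?_, ?_⟩⟩
  · rw [tlo_apply, tlo_apply]; nlinarith [ha i]
  · rw [tlo_apply, thi_apply]; nlinarith [hb i]
  · rw [tlo_apply, thi_apply]; nlinarith [ha i]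
  · rw [thi_apply, thi_apply]; nlinarith [hb i]

/-- `loK L k z = tlo L z k` (the two lineages' names for the lower corner `Lᵏz` of `Bᵏ(c₋)`). [cite: Balaban1985Averaging, p.24 (the box `Bᵏ(c₋) ∪ Bᵏ(c₊)`; bookkeeping)] -/
theorem loK_eq_tlo (L k : ℕ) (z : Site d) : loK L k z = tlo L z k := by
  funext i; rw [tlo_apply]; rfl

/-- `bondHiK L k z κ = thi L (z + e_κ) k` (the two lineages' names for the upper corner of `Bᵏ(c₋) ∪ Bᵏ(c₊)`). [cite: Balaban1985Averaging, p.24 (the box `Bᵏ(c₋) ∪ Bᵏ(c₊)`; bookkeeping)] -/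
theorem bondHiK_eq_thi (L k : ℕ) (z : Site d) (κ : Fin d) : bondHiK L k z κ = thi L (z + e κ) k := by
  funext i
  rw [thi_apply, add_e_apply]
  simp only [bondHiK]
  split_ifs <;> ring

/-- `bondHi L (L•z) κ = thi L (z + e_κ) 1` (the two lineages' names for the upper corner of `B(c₋) ∪ B(c₊)`). [cite: Balaban1985Averaging, p.24 (the box `B(c₋) ∪ B(c₊)`; bookkeeping)] -/
theorem bondHi_eq_thi (L : ℕ) (z : Site d) (κ : Fin d) : bondHi L ((L : ℤ) • z) κ = thi L (z + e κ) 1 := by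
  funext i
  rw [thi_apply, add_e_apply]
  simp only [bondHi, Pi.smul_apply, smul_eq_mul, pow_one]
  split_ifs <;> ring

/-! ## §3 The extensions: the clamped background, `u′ ∘ π`, and `u₁` continued by `1` -/

section Extension

variable {G : Type*} [Group G] {lo hi : Site d}

open Classical in
/-- **`u` on the box, `1` outside** — the extension of the AVERAGED gauge transformation (`v₁` of (180), `u₁ ∈ Λ_k` of Prop. 10): on a block outside
the box it is the identity, whose twisted averages are the identity and whose (166)/(167)/(180c,d) expressions vanish identically (device, not in print).
[cite: Balaban1985Averaging, (166)–(167) p.44, (180) p.46] -/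
def extOne (lo hi : Site d) (u : Site d → G) : Site d → G := fun x => if InBox lo hi x then u x else 1

/-- `extOne = u` on the box. [cite: Balaban1985Averaging, (166)–(167) p.44 (bookkeeping of the extension device, not in print)] -/
theorem extOne_of_inBox {u : Site d → G} {x : Site d} (hx : InBox lo hi x) : extOne lo hi u x = u x := by
  unfold extOne; rw [if_pos hx]

/-- `extOne = 1` off the box. [cite: Balaban1985Averaging, (166)–(167) p.44 (bookkeeping of the extension device, not in print)] -/
theorem extOne_of_not_inBox {u : Site d → G} {x : Site d} (hx : ¬ InBox lo hi x) : extOne lo hi u x = 1 := by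
  unfold extOne; rw [if_neg hx]

/-- `extOne` is multiplicative (the product `u = u₁u₂` of Prop. 8 extends to the product of the extensions). [cite: Balaban1985Averaging, Proposition 8 p.45 (bookkeeping of the extension device)] -/
theorem extOne_mul (u₁ u₂ : Site d → G) : extOne lo hi (u₁ * u₂) = extOne lo hi u₁ * extOne lo hi u₂ := by
  funext x
  by_cases hx : InBox lo hi x
  · simp only [Pi.mul_apply, extOne_of_inBox hx]
  · simp only [Pi.mul_apply, extOne_of_not_inBox hx, mul_one]

/-- `extOne u` takes values in any subgroup containing the values of `u` on the box (`G`-valued gauge transformations, p. 18). [cite: Balaban1985Averaging, p.18, (166) p.44 (bookkeeping of the extension device)] -/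
theorem extOne_mem {S : Subgroup G} {u : Site d → G} (hu : ∀ x : Site d, InBox lo hi x → u x ∈ S) (x : Site d) :
    extOne lo hi u x ∈ S := by
  by_cases hx : InBox lo hi x
  · rw [extOne_of_inBox hx]; exact hu x hx
  · rw [extOne_of_not_inBox hx]; exact S.one_mem

/-- **`u ∘ π`** — the extension of the gauge transformation `u′` of (176)–(177) ∕ `v′` of (180a,b) by the coordinate retraction `π` onto the box
(`B7Prop1Local.clamp`; device, not in print). [cite: Balaban1985Averaging, (176)–(177) p.45, (180) p.46] -/
def compClamp (lo hi : Site d) (u : Site d → G) : Site d → G := fun x => u (clamp lo hi x)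

omit [Group G] in
/-- `compClamp = u` on the box. [cite: Balaban1985Averaging, (176)–(177) p.45 (bookkeeping of the extension device, not in print)] -/
theorem compClamp_of_inBox {u : Site d → G} {x : Site d} (hx : InBox lo hi x) : compClamp lo hi u x = u x := by
  unfold compClamp; rw [clamp_of_inBox hx]

end Extension

/-! ## §4 Transfer: the box-local hypotheses of the data imply the global hypotheses of the extended data -/

section Transfer

variable {𝔸 : Type*} [NormedRing 𝔸] {lo hi : Site d}

/-- (176)/(180a) on the box ⟹ (176)/(180a) everywhere for `u ∘ π`. [cite: Balaban1985Averaging, (176) p.45, (180) p.46] -/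
theorem siteBd_compClamp (hlohi : ∀ i, lo i ≤ hi i) {v : Site d → 𝔸ˣ} {α : ℝ} (h : SiteBdOn lo hi v α) :
    SiteBd (compClamp lo hi v) α := fun x => h _ (clamp_inBox hlohi x)

/-- (180c)/(166)₀ on the box ⟹ everywhere for the extension by `1`. [cite: Balaban1985Averaging, (166) p.44, (180) p.46] -/
theorem siteBd_extOne {v : Site d → 𝔸ˣ} {α : ℝ} (hα : 0 ≤ α) (h : SiteBdOn lo hi v α) : SiteBd (extOne lo hi v) α := fun x => by
  by_cases hx : InBox lo hi x
  · rw [extOne_of_inBox hx]; exact h x hx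
  · rw [extOne_of_not_inBox hx, Units.val_one, sub_self, norm_zero]; exact hα

/-- **(177)/(180b) on the box ⟹ everywhere** for the clamped background and `u ∘ π`: on a bond whose clamped image is a genuine bond of the box the
expression is that bond's, on the others the background is `1` and both ends clamp to the same site, so the expression is `1`. [cite: Balaban1985Averaging, (177) p.45, (180) p.46, (56) p.27] -/
theorem covBondBd_clamp (hlohi : ∀ i, lo i ≤ hi i) {V₀ : Site d → Fin d → 𝔸ˣ} {v : Site d → 𝔸ˣ} {α : ℝ} (hα : 0 ≤ α)
    (h : CovBondBdOn lo hi V₀ v α) : CovBondBd (clampCfg lo hi V₀) (compClamp lo hi v) α := fun x κ => by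
  by_cases hP : lo κ ≤ x κ ∧ x κ < hi κ
  · have hx : InBox lo hi (clamp lo hi x) := clamp_inBox hlohi x
    have hxe : InBox lo hi (clamp lo hi x + e κ) := by rw [← clamp_add_e_of hP]; exact clamp_inBox hlohi _
    have hV : clampCfg lo hi V₀ x κ = V₀ (clamp lo hi x) κ := by unfold clampCfg; rw [if_pos hP]
    simp only [compClamp, hV, clamp_add_e_of hP]
    exact h _ κ hx hxe
  · have hV : clampCfg lo hi V₀ x κ = 1 := by unfold clampCfg; rw [if_neg hP]
    simp only [compClamp, hV, clamp_add_e_of_not (hlohi κ) hP, Rc_one_apply, inv_mul_cancel, Units.val_one, sub_self,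
      norm_zero]
    exact hα

variable [NormOneClass 𝔸] [NormedAlgebra ℂ 𝔸] [CompleteSpace 𝔸]

omit [NormOneClass 𝔸] [NormedAlgebra ℂ 𝔸] [CompleteSpace 𝔸] in
/-- **(180d) on the box ⟹ everywhere** for the clamped background and the extension by `1` of `v₁`, box = a union of blocks `[La, L(b+𝟙) − 𝟙]`: a block is
inside the box (then the expression is the box's: the tree contours stay in the block, `B7Prop1Local.hol_treeWord_congr`) or misses it (then `v₁ = 1` at both
ends and the expression is `1`). [cite: Balaban1985Averaging, (180) p.46, p.27 (display after (59)), p.24] -/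
theorem covBlockBd_ext {L : ℕ} (hL : 1 ≤ L) {a b : Site d} {V₀ : Site d → Fin d → 𝔸ˣ} {v : Site d → 𝔸ˣ} {β : ℝ} (hβ : 0 ≤ β)
    (h : CovBlockBdOn L (tlo L a 1) (thi L b 1) V₀ v β) :
    CovBlockBd L (clampCfg (tlo L a 1) (thi L b 1) V₀) (extOne (tlo L a 1) (thi L b 1) v) β := fun w r => by
  have h1 := smul_mem hL (show tlo L w 0 ≤ w by rw [tlo_zero]) (show w ≤ thi L w 0 by rw [thi_zero])
  have h2 := block_mem (L := L) (show tlo L w 0 ≤ w by rw [tlo_zero]) (show w ≤ thi L w 0 by rw [thi_zero]) r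
  rcases blockIn_or_disjoint hL (le_refl 1) w with hw | hw
  · have hy : InBox (tlo L a 1) (thi L b 1) ((L : ℤ) • w) := inBox_of_blockIn hw h1.1 h1.2
    have hx : InBox (tlo L a 1) (thi L b 1) ((L : ℤ) • w + boxVec L r) := inBox_of_blockIn hw h2.1 h2.2
    simp only [R0fun_apply, add_sub_cancel_left, extOne_of_inBox hy, extOne_of_inBox hx]
    rw [hol_treeWord_congr (agreeOn_block hw (clampCfg_agree V₀)) _ _ (inBox_of_le h1.1 h1.2) (inBox_of_le h2.1 h2.2)]
    have h' := h w r hw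
    simp only [R0fun_apply, add_sub_cancel_left] at h'
    exact h'
  · have hy : ¬ InBox (tlo L a 1) (thi L b 1) ((L : ℤ) • w) := hw _ (inBox_of_le h1.1 h1.2)
    have hx : ¬ InBox (tlo L a 1) (thi L b 1) ((L : ℤ) • w + boxVec L r) := hw _ (inBox_of_le h2.1 h2.2)
    simp only [R0fun_apply, extOne_of_not_inBox hy, extOne_of_not_inBox hx, map_one, inv_one, one_mul, Units.val_one,
      sub_self, norm_zero]
    exact hβ

omit [NormOneClass 𝔸] in
/-- The twisted averages (79)/(80) of the identity gauge transformation are the identity, at every background and every level. [cite: Balaban1985Averaging, (78)–(80) p.30] -/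
theorem uavg_one_fun (L : ℕ) (W : Site d → Fin d → 𝔸ˣ) : ∀ (j : ℕ) (w : Site d), uavg L W (1 : Site d → 𝔸ˣ) j w = 1
  | 0, w => rfl
  | j + 1, w => by
    rw [uavg_succ, R0avg]
    have hc : ∀ x : Site d, R0fun (avgIter L W j) ((L : ℤ) • w) (uavg L W (1 : Site d → 𝔸ˣ) j) x = (fun _ : Site d => (1 : 𝔸ˣ)) x :=
      fun x => by rw [R0fun_apply, uavg_one_fun L W j, map_one]
    rw [savg_congr L (g' := fun _ : Site d => (1 : 𝔸ˣ)) (hc _) (fun r => hc _), savg_const]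

omit [NormOneClass 𝔸] in
/-- On a block INSIDE the box the twisted averages of `(π^*U₀, u continued by 1)` are those of `(U₀, u)` (n04-b's tower locality
`B8Ineq172Concrete.uavg_congr_tower`). [cite: Balaban1985Averaging, (78)–(80) p.30, p.24] -/
theorem uavg_ext_eq_of_blockIn {L : ℕ} (hL : 1 ≤ L) {U₀ : Site d → Fin d → 𝔸ˣ} {u : Site d → 𝔸ˣ} {j : ℕ} {w : Site d}
    (hw : BlockIn L lo hi j w) :
    uavg L (clampCfg lo hi U₀) (extOne lo hi u) j w = uavg L U₀ u j w :=
  uavg_congr_tower hL (agreeOn_block hw (clampCfg_agree U₀)) (fun x hx hx' => extOne_of_inBox (inBox_of_blockIn hw hx hx'))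
    j 0 (by omega) w (by rw [tlo_zero]) (by rw [thi_zero])

omit [NormOneClass 𝔸] in
/-- On a block MISSING the box the twisted averages of the extension by `1` are the identity, at any background. [cite: Balaban1985Averaging, (78)–(80) p.30, p.24] -/
theorem uavg_ext_eq_one_of_disjoint {L : ℕ} (hL : 1 ≤ L) (W : Site d → Fin d → 𝔸ˣ) {u : Site d → 𝔸ˣ} {j : ℕ} {w : Site d}
    (hw : ∀ x : Site d, InBox (tlo L w j) (thi L w j) x → ¬ InBox lo hi x) :
    uavg L W (extOne lo hi u) j w = 1 := by
  rw [← uavg_one_fun L W j w]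
  exact uavg_congr_tower hL (fun _ _ _ _ => rfl) (fun x hx hx' => extOne_of_not_inBox (hw x (inBox_of_le hx hx')))
    j 0 (by omega) w (by rw [tlo_zero]) (by rw [thi_zero])

omit [NormOneClass 𝔸] in
/-- **«`u₁ ∈ Λ_k(U₀, α₃)` on the box ⟹ `(u₁ continued by 1) ∈ Λ_k(π^*U₀, α₃)` everywhere»** for a box `[Lᵏa, Lᵏ(b+𝟙) − 𝟙]` (a union of level-`k`
blocks): each level-`j` block (`j ≤ k`) lies inside the box — then (166)/(167) are the box's own expressions (tower locality `uavg_congr_tower`,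
`expr167_congr_tower`) — or misses it — then the averages are the identity and (166)/(167) read `0 ≤ α₃`, `0 ≤ α₃Lʲ⁺¹η`.
[cite: Balaban1985Averaging, (166)–(167) p.44, (78)–(80) p.30, p.24] -/
theorem inLambda_ext {L : ℕ} (hL : 1 ≤ L) {a b : Site d} {k : ℕ} {U₀ : Site d → Fin d → 𝔸ˣ} {u : Site d → 𝔸ˣ} {α₃ η : ℝ}
    (hα₃ : 0 ≤ α₃) (hη : 0 ≤ η) (h : InLambdaOn L (tlo L a k) (thi L b k) U₀ u k α₃ η) :
    InLambda L (clampCfg (tlo L a k) (thi L b k) U₀) (extOne (tlo L a k) (thi L b k) u) k α₃ η := by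
  have hL0 : (0 : ℝ) ≤ L := Nat.cast_nonneg L
  refine ⟨fun j hj w => ?_, fun j hj w r => ?_⟩
  · rcases blockIn_or_disjoint hL hj w with hw | hw
    · rw [uavg_ext_eq_of_blockIn hL hw]; exact h.1 j hj w hw
    · rw [uavg_ext_eq_one_of_disjoint hL _ hw, Units.val_one, sub_self, norm_zero]; exact hα₃
  · rcases blockIn_or_disjoint hL (show j + 1 ≤ k by omega) w with hw | hw
    · rw [expr167_congr_tower hL (agreeOn_block hw (clampCfg_agree U₀))
        (fun x hx hx' => extOne_of_inBox (inBox_of_blockIn hw hx hx')) (show 0 + (j + 1) = j + 1 by omega)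
        (show tlo L w 0 ≤ w by rw [tlo_zero]) (show w ≤ thi L w 0 by rw [thi_zero]) r]
      exact h.2 j hj w r hw
    · -- both averaged transformations are the identity: their level-`j` blocks lie in `Bʲ⁺¹(w)`, which misses the box
      have h1 := smul_mem hL (show tlo L w 0 ≤ w by rw [tlo_zero]) (show w ≤ thi L w 0 by rw [thi_zero])
      have h2 := block_mem (L := L) (show tlo L w 0 ≤ w by rw [tlo_zero]) (show w ≤ thi L w 0 by rw [thi_zero]) r
      have hout : ∀ v : Site d, tlo L w 1 ≤ v → v ≤ thi L w 1 →
          ∀ x : Site d, InBox (tlo L v j) (thi L v j) x → ¬ InBox (tlo L a k) (thi L b k) x := by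
        intro v hv hv' x hx
        obtain ⟨hn1, hn2⟩ := tower_nest hL hv hv' j (show 1 + j = j + 1 by omega)
        exact hw x (fun i => ⟨(hn1 i).trans (hx i).1, (hx i).2.trans (hn2 i)⟩)
      rw [uavg_ext_eq_one_of_disjoint hL _ (hout _ h1.1 h1.2), uavg_ext_eq_one_of_disjoint hL _ (hout _ h2.1 h2.2), map_one,
        inv_one, one_mul, Units.val_one, sub_self, norm_zero]
      positivity

omit [NormOneClass 𝔸] in
/-- Conversely, «`(u continued by 1) ∈ Λ_k(π^*U₀, α)` everywhere ⟹ `u ∈ Λ_k(U₀, α)` on the box» (only the blocks inside the box are read).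
[cite: Balaban1985Averaging, (166)–(167) p.44, p.24] -/
theorem inLambdaOn_of_ext {L : ℕ} (hL : 1 ≤ L) {k : ℕ} {U₀ : Site d → Fin d → 𝔸ˣ} {u : Site d → 𝔸ˣ} {α₃ η : ℝ}
    (h : InLambda L (clampCfg lo hi U₀) (extOne lo hi u) k α₃ η) : InLambdaOn L lo hi U₀ u k α₃ η := by
  refine ⟨fun j hj w hw => ?_, fun j hj w r hw => ?_⟩
  · rw [← uavg_ext_eq_of_blockIn hL hw]; exact h.1 j hj w
  · rw [← expr167_congr_tower hL (agreeOn_block hw (clampCfg_agree U₀))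
        (fun x hx hx' => extOne_of_inBox (inBox_of_blockIn hw hx hx')) (show 0 + (j + 1) = j + 1 by omega)
        (show tlo L w 0 ≤ w by rw [tlo_zero]) (show w ≤ thi L w 0 by rw [thi_zero]) r]
    exact h.2 j hj w r

end Transfer


/-! ## §5 Sect. F one step: the local family and Proposition 9 (199)–(200) -/

section OneStepLocal

variable (𝔸 : Type) [NormedRing 𝔸] [NormOneClass 𝔸] [NormedAlgebra ℂ 𝔸] [CompleteSpace 𝔸]

/-- **The concrete one-step family of Sect. F WITH THE PRINTED LOCALITY** (index `i = (z, κ)` = the bond `c = ⟨Lz, Lz + Le_κ⟩` of `Ω′^{(1)}` at which (199)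
is read, (200) being read at `y = c₋ = Lz`; box `Q_c = B(c₋) ∪ B(c₊) = [Lz, L(z + e_κ + 𝟙) − 𝟙]`): `Cfg`, `GT` as `B7ConclGauge.concreteGaugeOneStep`
(`U1`-valued configurations, bounded unit site functions); the four HYPOTHESIS functionals of (180) are the suprema over the sites ∕ bonds ∕ blocks INSIDE
`Q_c` only (`plaqDev = pdevOn`, `dev`, `covDev`, `blockCovDev`); the two CONCLUSION functionals are the left sides of (199) AT `c` and of (200) AT `c₋`
(`vtilG` = ṽ′ of (178)). [cite: Balaban1985Averaging, (178)–(180) pp.45–46, (199)–(200) p.49, p.24 (locality)] -/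
def concreteGaugeOneStepLocal (L : ℕ) (i : Site d × Fin d) : B7.GaugeOneStep where
  Cfg := {V : Site d → Fin d → 𝔸ˣ // ∀ (x : Site d) (κ : Fin d), V x κ ∈ U1 𝔸}
  GT := BddUnits d 𝔸
  plaqDev V := pdevOn (tlo L i.1 1) (thi L (i.1 + e i.2) 1) V.1
  dev v := ⨆ x : {x : Site d // InBox (tlo L i.1 1) (thi L (i.1 + e i.2) 1) x}, ‖((v.1 x.1 : 𝔸ˣ) : 𝔸) - 1‖
  covDev V v := ⨆ b : {b : Site d × Fin d //
      InBox (tlo L i.1 1) (thi L (i.1 + e i.2) 1) b.1 ∧ InBox (tlo L i.1 1) (thi L (i.1 + e i.2) 1) (b.1 + e b.2)},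
    ‖((((v.1 b.1.1)⁻¹ * Rc (V.1 b.1.1 b.1.2) (v.1 (b.1.1 + e b.1.2)) : 𝔸ˣ)) : 𝔸) - 1‖
  blockCovDev V v := ⨆ p : {p : Site d × (Fin d → Fin L) // BlockIn L (tlo L i.1 1) (thi L (i.1 + e i.2) 1) 1 p.1},
    ‖((((v.1 ((L : ℤ) • p.1.1))⁻¹ * R0fun V.1 ((L : ℤ) • p.1.1) v.1 ((L : ℤ) • p.1.1 + boxVec L p.1.2) : 𝔸ˣ)) : 𝔸) - 1‖
  avgCovDev V v₁ v' :=
    ‖((((vtilG L V.1 v'.1 v₁.1 ((L : ℤ) • i.1))⁻¹ *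
        Rc (bavg L V.1 ((L : ℤ) • i.1) i.2) (vtilG L V.1 v'.1 v₁.1 ((L : ℤ) • (i.1 + e i.2))) : 𝔸ˣ)) : 𝔸) - 1‖
  avgDev V v₁ v' := ‖((vtilG L V.1 v'.1 v₁.1 ((L : ℤ) • i.1) : 𝔸ˣ) : 𝔸) - 1‖

end OneStepLocal

section Prop9Local

variable {𝔸 : Type} [NormedRing 𝔸] [NormOneClass 𝔸] [NormedAlgebra ℂ 𝔸] [CompleteSpace 𝔸]

omit [NormOneClass 𝔸] in
/-- The one-step operation ṽ′ (178) at the block corner `Lz` of a block INSIDE the box is the same for the data and for the extended data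
(`B8Eq1115Concrete.R0avg_congr_tower` at `m = 0`). [cite: Balaban1985Averaging, (178)–(179) p.45, (78) p.30, p.24] -/
theorem vtilG_ext_eq {L : ℕ} (hL : 1 ≤ L) {lo hi : Site d} {V₀ : Site d → Fin d → 𝔸ˣ} {v' v₁ : Site d → 𝔸ˣ} {z : Site d}
    (hz : BlockIn L lo hi 1 z) :
    vtilG L (clampCfg lo hi V₀) (compClamp lo hi v') (extOne lo hi v₁) ((L : ℤ) • z) = vtilG L V₀ v' v₁ ((L : ℤ) • z) := by
  have h₀ : AgreeOn (tlo L z 1) (thi L z 1) (clampCfg lo hi V₀) V₀ := agreeOn_block hz (clampCfg_agree V₀)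
  have hin : ∀ x : Site d, tlo L z (0 + 1) ≤ x → x ≤ thi L z (0 + 1) → InBox lo hi x := fun x hx hx' =>
    inBox_of_blockIn hz (by simpa using hx) (by simpa using hx')
  have hv₁ : ∀ x : Site d, tlo L z (0 + 1) ≤ x → x ≤ thi L z (0 + 1) → extOne lo hi v₁ x = v₁ x := fun x hx hx' =>
    extOne_of_inBox (hin x hx hx')
  have hv' : ∀ x : Site d, tlo L z (0 + 1) ≤ x → x ≤ thi L z (0 + 1) →
      (compClamp lo hi v' * extOne lo hi v₁) x = (v' * v₁) x := fun x hx hx' => by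
    rw [Pi.mul_apply, Pi.mul_apply, compClamp_of_inBox (hin x hx hx'), extOne_of_inBox (hin x hx hx')]
  have h1 := R0avg_congr_tower hL h₀ (show 0 + (0 + 1) = 1 by rfl) hv' (show tlo L z 0 ≤ z by rw [tlo_zero])
    (show z ≤ thi L z 0 by rw [thi_zero])
  have h2 := R0avg_congr_tower hL h₀ (show 0 + (0 + 1) = 1 by rfl) hv₁ (show tlo L z 0 ≤ z by rw [tlo_zero])
    (show z ≤ thi L z 0 by rw [thi_zero])
  simp only [avgIter_zero] at h1 h2
  rw [vtilG_apply, vtilG_apply, h1, h2]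

/-- **Proposition 9 (199)–(200) AS TYPED (`B7.Prop9Printed`) WITH THE PRINTED LOCALITY** for `concreteGaugeOneStepLocal 𝔸 L`, every `d`, `L ≥ 1`,
every ratio `M > 0`: the four conditions (180) are assumed on `B(c₋) ∪ B(c₊)` only; constants those of `B7ConclGauge.prop9Printed_G`
(`C′₄ = 2400(d+1)(d+4) + 1`, `C′₅ = 6d + 1`, `c′₆ = c9 d L`).  Proof: the pointwise kernels `B7Ineq199General.eq199_printed` ∕ `B7Ineq200General.eq200_printed`
at the extended data `(π^*V₀, v′ ∘ π, v₁ continued by 1)` (global (180) by §4), transported back at `c` (`vtilG_ext_eq`, `B7Prop1Local.bavg_congr`).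
[cite: Balaban1985Averaging, Proposition 9 (199)–(200) p.49, (180) p.46, p.24 (locality)] -/
theorem prop9Printed_G_local (L : ℕ) (hL : 1 ≤ L) :
    B7.Prop9Printed (L : ℝ) (concreteGaugeOneStepLocal 𝔸 (d := d) L) := by
  intro M _hM
  have hL0 : (0 : ℝ) < L := by exact_mod_cast hL
  have hd : (0 : ℝ) ≤ d := Nat.cast_nonneg d
  refine ⟨2400 * ((d : ℝ) + 1) * ((d : ℝ) + 4) + 1, 6 * (d : ℝ) + 1, c9 d L, by positivity, by positivity, c9_pos d hL, ?_⟩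
  rintro ⟨z₀, κ⟩ α₀ α₃ α₃' α₄ α₄' hα₀ hα₀c hα₃ hα₃c hα₃' hα₃'c hα₄ hα₄c hα₄' hα₄'c _hratio ⟨V₀, hV₀⟩ v' v₁ hdev h4a h4b h3c h3d
  dsimp only [concreteGaugeOneStepLocal] at hdev h4a h4b h3c h3d ⊢
  obtain ⟨c20, c50, c50L, c100, c512⟩ := c9_le d L
  -- the box `Q = B(c₋) ∪ B(c₊)`
  have hzz : z₀ ≤ z₀ + e κ := fun i => by rw [add_e_apply]; split_ifs <;> simp
  have hlohi : ∀ i, tlo L z₀ 1 i ≤ thi L (z₀ + e κ) 1 i := fun i => tlo_le_thi hL hzz 1 i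
  have hbz₀ : BlockIn L (tlo L z₀ 1) (thi L (z₀ + e κ) 1) 1 z₀ := blockIn_of_mem hL 1 le_rfl hzz
  have hbz₁ : BlockIn L (tlo L z₀ 1) (thi L (z₀ + e κ) 1) 1 (z₀ + e κ) := blockIn_of_mem hL 1 hzz le_rfl
  -- the pointwise hypotheses (180a)–(180d) ON THE BOX, with `≤`
  have h44 : ∀ (x : Site d) (μ ν : Fin d), μ ≠ ν → PlaqIn (tlo L z₀ 1) (thi L (z₀ + e κ) 1) (x, μ, ν) →
      ‖((hol V₀ x (plaqWord μ ν) : 𝔸ˣ) : 𝔸) - 1‖ ≤ α₀ :=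
    fun x μ ν _ hp => (B7Prop1Local.le_pdevOn hV₀ hp).trans hdev.le
  have hS' : SiteBdOn (tlo L z₀ 1) (thi L (z₀ + e κ) 1) v'.1 α₄ := fun x hx =>
    (le_ciSup ((dev_bddAbove v').mono (by rintro _ ⟨y, rfl⟩; exact ⟨y.1, rfl⟩)) ⟨x, hx⟩).trans h4a.le
  have hC' : CovBondBdOn (tlo L z₀ 1) (thi L (z₀ + e κ) 1) V₀ v'.1 α₄' := fun x ν hx hxe =>
    (le_ciSup ((covDev_bddAbove hV₀ v').mono (by rintro _ ⟨b, rfl⟩; exact ⟨b.1, rfl⟩)) ⟨(x, ν), hx, hxe⟩).trans h4b.le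
  have hS₁ : SiteBdOn (tlo L z₀ 1) (thi L (z₀ + e κ) 1) v₁.1 α₃ := fun x hx =>
    (le_ciSup ((dev_bddAbove v₁).mono (by rintro _ ⟨y, rfl⟩; exact ⟨y.1, rfl⟩)) ⟨x, hx⟩).trans h3c.le
  have hB₁ : CovBlockBdOn L (tlo L z₀ 1) (thi L (z₀ + e κ) 1) V₀ v₁.1 ((L : ℝ) * α₃') := fun w r hw =>
    (le_ciSup ((blockCovDev_bddAbove (L := L) hV₀ v₁).mono (by rintro _ ⟨p, rfl⟩; exact ⟨p.1, rfl⟩)) ⟨(w, r), hw⟩).trans h3d.le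
  -- the thresholds
  have hα₄s : α₄ ≤ 1 / 20 := hα₄c.trans c20
  have hα₃s : α₃ ≤ 1 / 50 := hα₃c.trans c50
  have hα₃'s : 50 * ((L : ℝ) * α₃') ≤ 1 := by
    have h := hα₃'c.trans c50L
    rw [le_div_iff₀ (by positivity)] at h
    linarith
  have hs : 100 * ((d : ℝ) * L * α₄') ≤ 1 := by
    have h := hα₄'c.trans c100
    rw [le_div_iff₀ (by positivity)] at h
    nlinarith
  have hα₀s : 512 * ((d : ℝ) + 1) * ((d : ℝ) + 4) * (L : ℝ) ^ 2 * α₀ ≤ 1 := by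
    have h := hα₀c.trans c512
    rw [le_div_iff₀ (by positivity)] at h
    linarith
  -- the extended data and their GLOBAL hypotheses
  have hV1 : ∀ (x : Site d) (ν : Fin d), clampCfg (tlo L z₀ 1) (thi L (z₀ + e κ) 1) V₀ x ν ∈ U1 𝔸 := B7Prop1Local.clampCfg_mem hV₀
  have h44' : ∀ (x : Site d) (μ ν : Fin d), μ ≠ ν →
      ‖((hol (clampCfg (tlo L z₀ 1) (thi L (z₀ + e κ) 1) V₀) x (plaqWord μ ν) : 𝔸ˣ) : 𝔸) - 1‖ ≤ α₀ :=
    fun x μ ν hμν => norm_hol_plaqWord_clampCfg_le hlohi V₀ hμν hα₀.le (fun y hp => h44 y μ ν hμν hp) x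
  have hS'' := siteBd_compClamp hlohi hS'
  have hC'' := covBondBd_clamp hlohi hα₄'.le hC'
  have hS₁' := siteBd_extOne hα₃.le hS₁
  have hB₁' := covBlockBd_ext hL (by positivity) hB₁
  have h199 := B7Ineq199General.eq199_printed hL hV1 hα₀.le h44' hS'' hC'' hS₁' hB₁' hα₄s hα₄'.le hα₃s hα₃'s hs hα₀s z₀ κ
  have h200 := B7Ineq200General.eq200_printed hL hV1 hS'' hC'' hS₁' hB₁' (hα₄s.trans (by norm_num)) hα₄'.le hα₃s
    (by linarith) hs z₀
  -- back to the data at `c`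
  rw [vtilG_ext_eq hL hbz₀, vtilG_ext_eq hL hbz₁,
    bavg_congr L hL ((L : ℤ) • z₀) κ (by rw [bondHi_eq_thi]; exact clampCfg_agree V₀)] at h199
  rw [vtilG_ext_eq hL hbz₀] at h200
  refine ⟨lt_of_le_of_lt h199 ?_, lt_of_le_of_lt h200 ?_⟩
  · have hβ : 0 < (L : ℝ) ^ 2 * (α₀ * α₄ + α₃' * α₄' + α₄' ^ 2) := by positivity
    nlinarith
  · have : 0 < (L : ℝ) * α₄' := by positivity
    nlinarith

end Prop9Local

/-! ## §6 Sects. E–F: the local gauge-transformation family and Propositions 8, 10 -/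

section GaugeDataLocal

variable (𝔸 : Type) [CStarAlgebra 𝔸] [Nontrivial 𝔸]

/-- **The index of the local gauge-transformation family**: the order `k`, the bond `c = ⟨z, z + e_κ⟩` of `Ω^{(k)}` at which (203) is read, and the
background `U₀` — `U(𝔸)`-valued and satisfying (52) at Prop. 2's `c₂` ON THE BOX `Q_c = Bᵏ(c₋) ∪ Bᵏ(c₊) = [Lᵏz, Lᵏ(z + e_κ + 𝟙) − 𝟙]` ONLY
(cf. `B7ConclGauge.GIdx`: the same data with (52) and `U(𝔸)`-valuedness on all of `ℤᵈ` — the located item (c2) of the N04 reading).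
[cite: Balaban1985Averaging, (52) p.26, (177) p.45, p.24] -/
structure GIdxLocal (d L : ℕ) where
  /-- the order `k` (`η = L^{−k}`) -/
  k : ℕ
  /-- the starting point `z = c₋` of the bond `c` of `Ω^{(k)}` -/
  z : Site d
  /-- the direction of `c` -/
  κ : Fin d
  /-- the background `U₀` -/
  U₀ : Site d → Fin d → 𝔸ˣ
  /-- `U₀` is `U(𝔸)`-valued on the bonds of `Q_c` -/
  hU₀ : ∀ (x : Site d) (ν : Fin d), InBox (tlo L z k) (thi L (z + e κ) k) x → InBox (tlo L z k) (thi L (z + e κ) k) (x + e ν) →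
    U₀ x ν ∈ unitaryUnits 𝔸
  /-- (52) at `α₀ = c₂` on `Q_c` -/
  h52 : pdevOn (tlo L z k) (thi L (z + e κ) k) U₀ * ((L : ℝ) ^ k) ^ 2 < cB d L

/-- **The concrete gauge-transformation family of Sects. E–F WITH THE PRINTED LOCALITY**: as `B7ConclGauge.concreteGaugeData` (`Cfg i = {V // V = U₀}`,
`GT` = all unit site functions, `mul` pointwise), with every hypothesis read ON THE BOX `Q_c` — `plaqDevEta = η⁻²·pdevOn Q_c`, `InLambda V α₃ u` = «`u`
is `U(𝔸)`-valued on `Q_c` and `u ∈ Λ_k(V, α₃)` on `Q_c`» (`InLambdaOn`), `Reg176 α₄ u′` = (176) and (177) on `Q_c` — and the conclusions (203)ⱼ ∕ (204)ⱼ,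
`j ≤ k`, read as the suprema over the level-`j` bonds `b` with `Bʲ(b₋) ∪ Bʲ(b₊) ⊂ Q_c`, resp. the level-`j` sites `y` with `Bʲ(y) ⊂ Q_c` (for `j = k`:
the bond `c` itself, resp. its two endpoints). [cite: Balaban1985Averaging, (166)–(167) p.44, (176)–(179) p.45, (203)–(204) p.49, p.24 (locality)] -/
def concreteGaugeDataLocal (L : ℕ) (i : GIdxLocal 𝔸 d L) : B7.GaugeData where
  Cfg := {V : Site d → Fin d → 𝔸ˣ // V = i.U₀}
  GT := Site d → 𝔸ˣ
  k := i.k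
  eta := ((L : ℝ) ^ i.k)⁻¹
  L := L
  plaqDevEta V := pdevOn (tlo L i.z i.k) (thi L (i.z + e i.κ) i.k) V.1 * ((L : ℝ) ^ i.k) ^ 2
  InLambda V α₃ u := (∀ x : Site d, InBox (tlo L i.z i.k) (thi L (i.z + e i.κ) i.k) x → u x ∈ unitaryUnits 𝔸) ∧
    InLambdaOn L (tlo L i.z i.k) (thi L (i.z + e i.κ) i.k) V.1 u i.k α₃ (((L : ℝ) ^ i.k)⁻¹)
  mul u₁ u₂ := u₁ * u₂
  Reg176 α₄ u' := SiteBdOn (tlo L i.z i.k) (thi L (i.z + e i.κ) i.k) u' α₄ ∧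
    CovBondBdOn (tlo L i.z i.k) (thi L (i.z + e i.κ) i.k) i.U₀ u' (α₄ * ((L : ℝ) ^ i.k)⁻¹)
  avgDev203 V u₁ u' j := ⨆ b : {b : Site d × Fin d // BlockIn L (tlo L i.z i.k) (thi L (i.z + e i.κ) i.k) j b.1 ∧
      BlockIn L (tlo L i.z i.k) (thi L (i.z + e i.κ) i.k) j (b.1 + e b.2)},
    ‖((((utilG L V.1 u' u₁ j b.1.1)⁻¹ * Rc (avgIter L V.1 j b.1.1 b.1.2) (utilG L V.1 u' u₁ j (b.1.1 + e b.1.2)) : 𝔸ˣ)) : 𝔸) - 1‖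
  avgDev204 V u₁ u' j := ⨆ y : {y : Site d // BlockIn L (tlo L i.z i.k) (thi L (i.z + e i.κ) i.k) j y},
    ‖((utilG L V.1 u' u₁ j y.1 : 𝔸ˣ) : 𝔸) - 1‖

end GaugeDataLocal

section Props810Local

variable {𝔸 : Type} [CStarAlgebra 𝔸] [Nontrivial 𝔸]

omit [Nontrivial 𝔸] in
/-- `ũ′ʲ` (178)∕(179) at a level-`j` site whose block lies INSIDE the box is the same for the data and for the extended data (n04-b's
`B8Eq1115Concrete.utilG_congr_tower`). [cite: Balaban1985Averaging, (178)–(179) p.45, p.24] -/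
theorem utilG_ext_eq {L : ℕ} (hL : 1 ≤ L) {lo hi : Site d} {U₀ : Site d → Fin d → 𝔸ˣ} {u' u₁ : Site d → 𝔸ˣ} {j : ℕ} {w : Site d}
    (hw : BlockIn L lo hi j w) :
    utilG L (clampCfg lo hi U₀) (compClamp lo hi u') (extOne lo hi u₁) j w = utilG L U₀ u' u₁ j w :=
  utilG_congr_tower hL (agreeOn_block hw (clampCfg_agree U₀))
    (fun x hx hx' => compClamp_of_inBox (inBox_of_blockIn hw hx hx'))
    (fun x hx hx' => extOne_of_inBox (inBox_of_blockIn hw hx hx')) j 0 (by omega) w (by rw [tlo_zero]) (by rw [thi_zero])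

omit [Nontrivial 𝔸] in
/-- `Ū₀ʲ(b)` (43) at a level-`j` bond `b` with `Bʲ(b₋) ∪ Bʲ(b₊)` INSIDE the box is the same for `U₀` and `π^*U₀` (`B7Prop1Local.avgIter_congr`).
[cite: Balaban1985Averaging, (43) p.24] -/
theorem avgIter_ext_eq {L : ℕ} (hL : 1 ≤ L) {lo hi : Site d} {U₀ : Site d → Fin d → 𝔸ˣ} {j : ℕ} {w : Site d} {ν : Fin d}
    (hw : BlockIn L lo hi j w) (hwe : BlockIn L lo hi j (w + e ν)) :
    avgIter L (clampCfg lo hi U₀) j w ν = avgIter L U₀ j w ν := by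
  refine avgIter_congr L hL j w ν ?_
  rw [loK_eq_tlo, bondHiK_eq_thi]
  exact (clampCfg_agree U₀).mono (fun i => (hw.1 i).1) (fun i => (hwe.2 i).2)

/-- **Proposition 8 AS TYPED (`B7.Prop8Printed`) WITH THE PRINTED LOCALITY** for `concreteGaugeDataLocal 𝔸 L` (`L ≥ 2`; `G = U(𝔸)`): `C₃ = 1116`, `c₆ = 1/3000`
(as `B7ConclGauge.prop8Printed_G`): if `u₁, u₂` are `U(𝔸)`-valued on `Q_c` and belong to `Λ_k(U₀, α₃)` ON `Q_c`, then so does `u₁u₂` with `2α₃ + 2C₃α₃²`.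
Proof: `B7Prop8PrintedConstants.prop8_printed_of52` at the extended data `(π^*U₀, u₁ continued by 1, u₂ continued by 1)` (`inLambda_ext`), restricted back
(`inLambdaOn_of_ext`, `extOne_mul`). [cite: Balaban1985Averaging, Proposition 8 p.45, (166)–(167) p.44, p.24] -/
theorem prop8Printed_G_local (L : ℕ) (hL : 2 ≤ L) : B7.Prop8Printed (concreteGaugeDataLocal 𝔸 (d := d) L) := by
  have hL1 : 1 ≤ L := le_trans (by norm_num) hL
  have hL0 : (0 : ℝ) < L := by exact_mod_cast hL1
  refine ⟨1116, 1 / 3000, by norm_num, by norm_num, ?_⟩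
  rintro ⟨k, z₀, κ, U₀, hU₀, h52⟩ α₃ hα₃ hα₃c ⟨V, hVU⟩ u₁ u₂ ⟨hu₁, h₁⟩ ⟨hu₂, h₂⟩
  dsimp only [concreteGaugeDataLocal] at hVU u₁ u₂ hu₁ hu₂ h₁ h₂ ⊢
  subst hVU
  refine ⟨fun x hx => (unitaryUnits 𝔸).mul_mem (hu₁ x hx) (hu₂ x hx), ?_⟩
  obtain ⟨hB3, hB2⟩ := cB_spec d L
  have hη : (0 : ℝ) ≤ ((L : ℝ) ^ k)⁻¹ := by positivity
  have hk : (L : ℝ) ^ k * ((L : ℝ) ^ k)⁻¹ ≤ 1 := by rw [mul_inv_cancel₀ (by positivity)]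
  have hzz : z₀ ≤ z₀ + e κ := fun i => by rw [add_e_apply]; split_ifs <;> simp
  have hlohi : ∀ i, tlo L z₀ k i ≤ thi L (z₀ + e κ) k i := fun i => tlo_le_thi hL1 hzz k i
  -- the extended data
  have hŨ : ∀ (x : Site d) (ν : Fin d), clampCfg (tlo L z₀ k) (thi L (z₀ + e κ) k) V x ν ∈ unitaryUnits 𝔸 :=
    clampCfg_mem_of_box hlohi hU₀
  have hle := pdev_clampCfg_le_of_box hlohi (fun x ν hx hxe => unitaryUnits_le_U1 (hU₀ x ν hx hxe))
  have h52' : pdev (clampCfg (tlo L z₀ k) (thi L (z₀ + e κ) k) V) < cB d L * (((L : ℝ) ^ k)⁻¹) ^ 2 :=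
    h52_of_lt hL1 (lt_of_le_of_lt (mul_le_mul_of_nonneg_right hle (by positivity)) h52)
  have h := B7Prop8PrintedConstants.prop8_printed_of52 hL hη hk hα₃.le hα₃c hŨ (extOne_mem hu₁) (extOne_mem hu₂)
    (cB_pos d hL1) hB3 hB2 h52' (inLambda_ext hL1 hα₃.le hη h₁) (inLambda_ext hL1 hα₃.le hη h₂)
  rw [← extOne_mul] at h
  exact inLambdaOn_of_ext hL1 h

/-- **Proposition 10 (203)–(204) AS TYPED (`B7.Prop10Printed`) WITH THE PRINTED LOCALITY** for `concreteGaugeDataLocal 𝔸 L` (`L ≥ 2`; `G = U(𝔸)`):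
constants those of `B7ConclGauge.prop10Printed_G` (`C₄ = C4 d + 1`, `C′₅ = C5' d + 1`, `c₆ = c10 d L`); hypotheses (52), (176)–(177), (166)–(167) ON
`Q_c = Bᵏ(c₋) ∪ Bᵏ(c₊)` only; conclusions (203)ⱼ at the level-`j` bonds `b` with `Bʲ(b₋) ∪ Bʲ(b₊) ⊂ Q_c` and (204)ⱼ at the level-`j` sites `y` with
`Bʲ(y) ⊂ Q_c`, `j ≤ k`.  Proof: `B7Prop10AsPrinted.prop10_as_printed_of52` at the extended data `(π^*U₀, u′ ∘ π, u₁ continued by 1)` — global hypotheses by §4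
(`covBondBd_clamp`, `inLambda_ext`) — gives (203)/(204) at every level-`j` bond ∕ site of `ℤᵈ` for the extended data; at the bonds ∕ sites inside `Q_c`
these are the data's own (`utilG_ext_eq`, `avgIter_ext_eq`). [cite: Balaban1985Averaging, Proposition 10 p.50, (203)–(204) p.49, (176)–(177) p.45, (166)–(167) p.44, p.24] -/
theorem prop10Printed_G_local (L : ℕ) (hL : 2 ≤ L) : B7.Prop10Printed (concreteGaugeDataLocal 𝔸 (d := d) L) := by
  have hL1 : 1 ≤ L := le_trans (by norm_num) hL
  have hL0 : (0 : ℝ) < L := by exact_mod_cast hL1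
  have hd : (0 : ℝ) ≤ d := Nat.cast_nonneg d
  have hC5' := B7Prop10Flat.C5'_nonneg (d := d)
  have hC5 : 0 < B7Prop10Flat.C5 d := by linarith [B7Prop10Flat.one_le_C5 (d := d)]
  have hC4' : 0 < B7Prop9Flat.C4' d := by unfold B7Prop9Flat.C4'; positivity
  have hC40 : 0 < B7Prop10Flat.C4 d := by unfold B7Prop10Flat.C4; positivity
  refine ⟨B7Prop10Flat.C4 d + 1, B7Prop9Flat.C5' d + 1, c10 d L, by positivity, by positivity, c10_pos d hL1, ?_⟩
  rintro ⟨k, z₀, κ, U₀, hU₀, h52B⟩ α₀ α₃ α₄ hα₀ hα₀c hα₃ hα₃c hα₄ hα₄c ⟨V, hVU⟩ u' u₁ hdev ⟨h176, h177⟩ ⟨hu₁, hΛ⟩ j hj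
  dsimp only [concreteGaugeDataLocal] at hVU u' u₁ hdev h176 h177 hu₁ hΛ hj ⊢
  subst hVU
  obtain ⟨cBle, c50, c20, c200, c3C4, c1024⟩ := c10_le d L
  obtain ⟨hB3, hB2⟩ := cB_spec d L
  -- the `α₀`-regime (finer than the index's): `C₀α₀ ≤ ⅓`, `2α₀ ≤ c₂′`
  have hα₀B : α₀ ≤ cB d L := hα₀c.trans cBle
  have hα3 : C0 d * α₀ ≤ 1 / 3 := (mul_le_mul_of_nonneg_left hα₀B (C0_pos d).le).trans hB3
  have hα2 : 2 * α₀ ≤ c2' d L := by linarith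
  -- the smallness of `prop10_as_printed_of52`
  have hs₁ : 20 * B7Prop10Flat.C5 d * α₄ ≤ 1 := by
    have h := hα₄c.trans c20
    rw [le_div_iff₀ (by positivity)] at h
    linarith
  have hs₂ : 200 * (d : ℝ) * L * α₄ ≤ 1 := by
    have h := hα₄c.trans c200
    rw [le_div_iff₀ (by positivity)] at h
    nlinarith
  have hs₃ : B7Prop10Flat.C4 d * (α₀ + α₃ + α₄) ≤ 1 := by
    have h0 := hα₀c.trans c3C4
    have h3 := hα₃c.trans c3C4
    have h4 := hα₄c.trans c3C4
    rw [le_div_iff₀ (by positivity)] at h0 h3 h4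
    nlinarith
  have hs₄ : 1024 * ((d : ℝ) + 1) * ((d : ℝ) + 4) * (L : ℝ) ^ 2 * α₀ ≤ 1 := by
    have h := hα₀c.trans c1024
    rw [le_div_iff₀ (by positivity)] at h
    linarith
  -- the box and the extended data
  have hzz : z₀ ≤ z₀ + e κ := fun i => by rw [add_e_apply]; split_ifs <;> simp
  have hlohi : ∀ i, tlo L z₀ k i ≤ thi L (z₀ + e κ) k i := fun i => tlo_le_thi hL1 hzz k i
  have hη : (0 : ℝ) ≤ ((L : ℝ) ^ k)⁻¹ := by positivity
  have hŨ : ∀ (x : Site d) (ν : Fin d), clampCfg (tlo L z₀ k) (thi L (z₀ + e κ) k) V x ν ∈ unitaryUnits 𝔸 :=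
    clampCfg_mem_of_box hlohi hU₀
  have hle := pdev_clampCfg_le_of_box hlohi (fun x ν hx hxe => unitaryUnits_le_U1 (hU₀ x ν hx hxe))
  have h52 : pdev (clampCfg (tlo L z₀ k) (thi L (z₀ + e κ) k) V) < α₀ * (((L : ℝ) ^ k)⁻¹) ^ 2 :=
    h52_of_lt hL1 (lt_of_le_of_lt (mul_le_mul_of_nonneg_right hle (by positivity)) hdev)
  have h176' := siteBd_compClamp hlohi h176
  have h177' := covBondBd_clamp hlohi (by positivity) h177
  have hΛ' := inLambda_ext hL1 hα₃.le hη hΛ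
  obtain ⟨h203, h204⟩ := B7Prop10AsPrinted.prop10_as_printed_of52 hL (avgClosed_unitaryUnits d L) hŨ hα₀ hα3 hα2 h52 h176' h177'
    hΛ' hα₃.le (hα₃c.trans c50) hα₄.le hs₁ hs₂ hs₃ hs₄ j hj
  have ht : 0 < (L : ℝ) ^ j * ((L : ℝ) ^ k)⁻¹ := by positivity
  have hβ : 0 < α₀ * α₄ + α₃ * α₄ + α₄ ^ 2 := by positivity
  refine ⟨?_, ?_⟩
  · -- (203) at the level-`j` bonds inside `Q_c`
    have hpt : ∀ b : {b : Site d × Fin d // BlockIn L (tlo L z₀ k) (thi L (z₀ + e κ) k) j b.1 ∧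
        BlockIn L (tlo L z₀ k) (thi L (z₀ + e κ) k) j (b.1 + e b.2)},
        ‖((((utilG L V u' u₁ j b.1.1)⁻¹ * Rc (avgIter L V j b.1.1 b.1.2) (utilG L V u' u₁ j (b.1.1 + e b.1.2)) : 𝔸ˣ)) : 𝔸) - 1‖
          ≤ α₄ * ((L : ℝ) ^ j * ((L : ℝ) ^ k)⁻¹) +
            B7Prop10Flat.C4 d * (α₀ * α₄ + α₃ * α₄ + α₄ ^ 2) * ((L : ℝ) ^ j * ((L : ℝ) ^ k)⁻¹) ^ 2 := by
      rintro ⟨⟨w, ν⟩, hw, hwe⟩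
      dsimp only
      rw [← utilG_ext_eq hL1 hw, ← utilG_ext_eq hL1 hwe, ← avgIter_ext_eq hL1 hw hwe]
      exact h203 w ν
    refine lt_of_le_of_lt (Real.iSup_le hpt (by positivity)) ?_
    nlinarith [mul_pos hβ (pow_pos ht 2)]
  · -- (204) at the level-`j` sites inside `Q_c`
    have h4 := rhs204_le_level (d := d) hL j hα₄.le hη
    have hpt : ∀ y : {y : Site d // BlockIn L (tlo L z₀ k) (thi L (z₀ + e κ) k) j y},
        ‖((utilG L V u' u₁ j y.1 : 𝔸ˣ) : 𝔸) - 1‖ ≤ α₄ * (1 + 4 * B7Prop9Flat.C5' d * ((L : ℝ) ^ j * ((L : ℝ) ^ k)⁻¹)) := by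
      rintro ⟨y, hy⟩
      dsimp only
      rw [← utilG_ext_eq hL1 hy]
      exact (h204 y).trans h4
    refine lt_of_le_of_lt (Real.iSup_le hpt (by positivity)) ?_
    nlinarith [mul_pos hα₄ ht]

/-- **The two gauge-transformation conjuncts of `B7.Concl` WITH THE PRINTED LOCALITY for ONE family**: `p8 ∧ p10` for `concreteGaugeDataLocal 𝔸 L`, `L ≥ 2`.
[cite: Balaban1985Averaging, Proposition 8 p.45, Proposition 10 p.50] -/
theorem p8_and_p10_G_local (L : ℕ) (hL : 2 ≤ L) :
    B7.Prop8Printed (concreteGaugeDataLocal 𝔸 (d := d) L) ∧ B7.Prop10Printed (concreteGaugeDataLocal 𝔸 (d := d) L) :=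
  ⟨prop8Printed_G_local L hL, prop10Printed_G_local L hL⟩

end Props810Local


/-! ## §7 The leaf `B7.Concl` INHABITED at carriers all of whose hypotheses are read on the printed boxes -/

section ConclLocal

variable (𝔸 : Type) [CStarAlgebra 𝔸] [Nontrivial 𝔸]

/-- **The union of the two local one-step families** — b07's `B7Prop1Local.concreteOneStepLocal` (index = a plaquette `p′` of `Ω′^{(1)}`, (44) on `Δ(p′)`,
genuine Prop-1 field, trivial Prop-3 fields) and `B7Prop3to7Local.concreteOneStepLocalC` (index = an `L`-bond `c`, (44) on `B(c₋) ∪ B(c₊)`, genuine Prop-3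
fields, trivial Prop-1 field) — ONE family `one` serving both `p1` and `p3` of `B7.Concl`, each proposition being the genuine one on its own summand and
trivially true on the other. [cite: Balaban1985Averaging, Prop. 1 (51) p.26, Prop. 3 (121)–(123) p.36, (46) p.25, p.34 (locality)] -/
def concreteOneStepLocalUnion (L : ℕ) :
    {p : Site d × Fin d × Fin d // p.2.1 ≠ p.2.2} ⊕ (Site d × Fin d) → B7.OneStep :=
  Sum.elim (B7Prop1Local.concreteOneStepLocal 𝔸 (d := d) L) (B7Prop3to7Local.concreteOneStepLocalC 𝔸 (d := d) L)

variable {𝔸}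

/-- Proposition 1 with the printed locality for the union family (b07's `prop1Printed_concrete_local` on the plaquette summand; on the bond summand the
Prop-1 field is `0 < L²α₀ + C₀(L²α₀)²`). [cite: Balaban1985Averaging, Prop. 1 (51) p.26] -/
theorem prop1Printed_localUnion (L : ℕ) (hL : 1 ≤ L) :
    B7.Prop1Printed (L : ℝ) (concreteOneStepLocalUnion 𝔸 (d := d) L) := by
  obtain ⟨C₀, c₂', hC₀, hc₂', h⟩ := B7Prop1Local.prop1Printed_concrete_local (𝔸 := 𝔸) (d := d) L hL
  refine ⟨C₀, c₂', hC₀, hc₂', ?_⟩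
  rintro (i | i) α₀ hα₀ hα₀c V hdev
  · exact h i α₀ hα₀ hα₀c V hdev
  · have hL0 : (0 : ℝ) < L := by exact_mod_cast hL
    show (0 : ℝ) < (L : ℝ) ^ 2 * α₀ + C₀ * ((L : ℝ) ^ 2 * α₀) ^ 2
    positivity

/-- Proposition 3 with the printed locality for the union family (`prop3Printed_localC` on the bond summand; on the plaquette summand the Prop-3 fields are
trivial: `True`, `0 ≤ C₁L²·0²`). [cite: Balaban1985Averaging, Prop. 3 (121)–(123) p.36] -/
theorem prop3Printed_localUnion (L : ℕ) (hL : 1 ≤ L) {c₂ : ℝ} (hc₂ : 0 < c₂) :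
    B7.Prop3Printed (L : ℝ) c₂ (concreteOneStepLocalUnion 𝔸 (d := d) L) := by
  obtain ⟨C₁, c₃, hC₁, hc₃, hc₃c₂, h⟩ := B7Prop3to7Local.prop3Printed_localC (𝔸 := 𝔸) (d := d) L hL hc₂
  refine ⟨C₁, c₃, hC₁, hc₃, hc₃c₂, ?_⟩
  rintro (i | i) α₀ α₁ hα₀ hα₀c hα₁ hα₁c V₀ hdev
  · refine ⟨trivial, fun A _ => ?_⟩
    show (0 : ℝ) ≤ C₁ * (L : ℝ) ^ 2 * (0 : ℝ) ^ 2
    positivity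
  · exact h i α₀ α₁ hα₀ hα₀c hα₁ hα₁c V₀ hdev

/-- **`B7.Concl` INHABITED AT THE LOCAL CARRIERS** — Propositions 1–10 of [Balaban1985Averaging] AS TYPED, every small-field ∕ regularity hypothesis read on
the box print names (Prop. 1: `Δ(p′)`; Prop. 2: the four corner `k`-blocks; Prop. 3: `B(c₋) ∪ B(c₊)`; Props. 4–7: `Bᵏ(c₋) ∪ Bᵏ(c₊)`; Prop. 9: `B(c₋) ∪ B(c₊)`;
Props. 8, 10: `Bᵏ(c₋) ∪ Bᵏ(c₊)`), for every `d`, every `L ≥ 2`, every nontrivial C⋆-algebra `𝔸` (print: `M_N(ℂ)`, operator norm) and `G = U(𝔸)`, with the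
constants of the global leaf `B7ConclConcrete.concl_concrete` (`c₂ = cB d L`, `C₀ = C0 d`, `c₂′ = c2' d L`).  Families: `one` = `concreteOneStepLocalUnion` (b07 ⊕ g2),
`kst` = b07's `B7Prop1Local.concreteKStepLocal`, `kexp` = `B7Prop3to7Local.concreteKExpLocal`, `gd` = `concreteGaugeDataLocal`, `gone` = `concreteGaugeOneStepLocal`.
The node statement of record (`Dag.B7_main` at `Node00.carriers₂∕₃`, global carriers) is UNCHANGED; this is the located item (g1) of its reading in kernel form.
[cite: Balaban1985Averaging, Props. 1–2 p.26, Prop. 3 p.36, Prop. 4 pp.38–39, Prop. 5 p.42, Props. 6–7 p.43, Prop. 8 p.45, Prop. 9 p.49, Prop. 10 p.50, p.24 (locality)] -/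
theorem concl_local (d L : ℕ) (hL : 2 ≤ L) (𝔸 : Type) [CStarAlgebra 𝔸] [Nontrivial 𝔸] :
    B7.Concl (L : ℝ) (cB d L) (C0 d) (c2' d L)
      (concreteOneStepLocalUnion 𝔸 (d := d) L)
      (B7Prop1Local.concreteKStepLocal d 𝔸 (unitaryUnits 𝔸) L)
      (B7Prop3to7Local.concreteKExpLocal 𝔸 (unitaryUnits 𝔸) (d := d) L)
      (concreteGaugeDataLocal 𝔸 (d := d) L)
      (concreteGaugeOneStepLocal 𝔸 (d := d) L) :=
  have hL1 : 1 ≤ L := le_trans (by norm_num) hL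
  { p1 := prop1Printed_localUnion L hL1
    p2 := B7Prop1Local.prop2Printed_concrete_local L hL (avgClosed_unitaryUnits d L)
    p3 := prop3Printed_localUnion L hL1 (cB_pos d hL1)
    p4 := B7Prop3to7Local.prop4Printed_K_local L hL (avgClosed_unitaryUnits d L)
    p5 := B7Prop3to7Local.prop5Printed_K_local L hL (avgClosed_unitaryUnits d L)
    p6 := B7Prop3to7Local.prop6Printed_K_local L hL (avgClosed_unitaryUnits d L)
    p7 := B7Prop3to7Local.prop7Printed_K_local L hL (avgClosed_unitaryUnits d L)
    p8 := prop8Printed_G_local L hL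
    p9 := prop9Printed_G_local L hL1
    p10 := prop10Printed_G_local L hL }

end ConclLocal


/-! ## §8 The local leaf at a subgroup `G ≤ U(𝔸)` of the averaged fields' gauge group — `SU(N)`, every `N` (cf. `B7ConclSubgroup`) -/

section Subgroup

variable {𝔸 : Type} [NormedRing 𝔸] [NormOneClass 𝔸] [NormedAlgebra ℂ 𝔸] [CompleteSpace 𝔸] {G G' : Subgroup 𝔸ˣ}

omit [NormOneClass 𝔸] in
/-- **Proposition 2 with the printed locality restricts to subgroups**: b07's local `k`-fold family at `G ≤ G′` is the `G′`-family restricted to `G`-valued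
configurations (cf. `B7ConclSubgroup.prop2Printed_concrete_of_le` for the global family). [cite: Balaban1985Averaging, Prop. 2 (52)–(54) p.26 + the sentence after (54)] -/
theorem prop2Printed_concreteLocal_of_le (h : G ≤ G') (L : ℕ) {C₀ c₂' : ℝ}
    (h2 : B7.Prop2Printed C₀ c₂' (B7Prop1Local.concreteKStepLocal d 𝔸 G' L)) :
    B7.Prop2Printed C₀ c₂' (B7Prop1Local.concreteKStepLocal d 𝔸 G L) := by
  intro i α₀ hα₀ hαc U hU
  obtain ⟨V, hV⟩ := U
  have h' := h2 i α₀ hα₀ hαc ⟨V, fun x κ => h (hV x κ)⟩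
  simp only [B7Prop1Local.concreteKStepLocal] at hU h' ⊢
  exact h' hU

end Subgroup

section SubgroupLeaf

open scoped Matrix.Norms.L2Operator

/-- **THE LOCAL LEAF FOR `SU(N)`-VALUED FIELDS, EVERY `N ≥ 1`** (`𝔸 = M_N(ℂ)` with the operator norm (19); gauge transformations in `U(N)` as in `concl_local`):
`B7.Concl` at the five local families with the `k`-step and `k`-fold families read at `SU(N) ≤ U(N)` — by the antitone transfers
`prop2Printed_concreteLocal_of_le`, `B7Prop3to7Local.p4567_K_local_of_le` from `concl_local` (cf. `B7ConclSubgroup.concl_specialUnitary` for the global leaf and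
its §4 caveat: the `SU(N)`-valuedness of the averages themselves is no part of the typed leaf). [cite: Balaban1985Averaging, Props. 1–10 pp.26–50, pp.18–21 (17)–(19) (setting; SU(N), every N), p.24 (locality)] -/
theorem concl_local_specialUnitary (N : ℕ) [NeZero N] (d L : ℕ) (hL : 2 ≤ L) :
    letI : CStarAlgebra (Matrix (Fin N) (Fin N) ℂ) := {}
    B7.Concl (L : ℝ) (cB d L) (C0 d) (c2' d L)
      (concreteOneStepLocalUnion (Matrix (Fin N) (Fin N) ℂ) (d := d) L)
      (B7Prop1Local.concreteKStepLocal d (Matrix (Fin N) (Fin N) ℂ) (B7Prop2SpecialUnitary.specialUnitaryUnits (Fin N)) L)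
      (B7Prop3to7Local.concreteKExpLocal (Matrix (Fin N) (Fin N) ℂ) (B7Prop2SpecialUnitary.specialUnitaryUnits (Fin N)) (d := d) L)
      (concreteGaugeDataLocal (Matrix (Fin N) (Fin N) ℂ) (d := d) L)
      (concreteGaugeOneStepLocal (Matrix (Fin N) (Fin N) ℂ) (d := d) L) := by
  letI : CStarAlgebra (Matrix (Fin N) (Fin N) ℂ) := {}
  have h := concl_local d L hL (Matrix (Fin N) (Fin N) ℂ)
  have hle := B7Prop2SpecialUnitary.specialUnitaryUnits_le_unitaryUnits (n := Fin N)
  obtain ⟨h4, h5, h6, h7⟩ := B7Prop3to7Local.p4567_K_local_of_le hle L ⟨h.p4, h.p5, h.p6, h.p7⟩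
  exact { p1 := h.p1, p2 := prop2Printed_concreteLocal_of_le hle L h.p2, p3 := h.p3, p4 := h4, p5 := h5, p6 := h6, p7 := h7,
          p8 := h.p8, p9 := h.p9, p10 := h.p10 }

end SubgroupLeaf

end Literature.MathematicalPhysics.QuantumFieldTheory.Balaban1983to89.B7Prop8to10Local

end
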